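import Mathlib.Analysis.InnerProductSpace.Orthogonal
import Mathlib.Analysis.Normed.Operator.LinearIsometry
import Mathlib.Geometry.Euclidean.Inversion.Basic
import Mathlib.MeasureTheory.Measure.Lebesgue.EqHaar
import Literature.Analysis.FunctionSpaces.PoissonMeckePrelims
import HarnessLib

/-!
# The chordal-nearest point of a configuration (stereographic / `S^d` chordal metric)
(topic Analysis/FunctionSpaces, next to `PoissonPointProcess`; definition request `defn-chordalNearest`
of route `ConformalPoissonDevice`, `CriticalPhenomena/Ising3DConformalLimit`: spins of the Poisson–Delaunay
Ising device are read at the device point chordally nearest to `x`)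

For a set `ω ⊆ E` of points of a real normed space and `x : E`, `chordalNearest ω x` is a point of
`ω` minimising the **chordal criterion**
`chordalCriterion x p = ‖x - p‖² / (1 + ‖p‖²)`,
equivalently (for fixed `x`) minimising the **chordal distance**
`chordalDist x p = 2‖x - p‖ / √((1 + ‖x‖²)(1 + ‖p‖²))`,
which is the Euclidean distance of the stereographic images of `x` and `p` on the unit sphere of
`E × ℝ` — the *chordal metric* of `ℝⁿ ∪ {∞}` (Beardon, *The Geometry of Discrete Groups* (1983), §3.1,
eq. (3.1.3); for `E = ℂ` the chordal metric of the Riemann sphere, Ahlfors, *Complex Analysis*, Ch. 1,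
"The Spherical Representation") — indeed `chordalDist x p ^ 2 = (4 / (1 + ‖x‖²)) · chordalCriterion x p`
(`chordalDist_sq`). When no minimiser exists the value is junk, and it is literally the route's inline
term `Classical.epsilon (fun p => p ∈ ω ∧ ∀ q ∈ ω, ‖x - p‖^2/(1+‖p‖^2) ≤ ‖x - q‖^2/(1+‖q‖^2))`
(`chordalNearest_coe`, by `rfl`, for `ω` a `PointConfig`).

## Main statements (all proved)

* existence: `exists_isChordalNearest` (finite nonempty `ω`), `chordalNearest_mem`,
  `chordalCriterion_chordalNearest_le`; uniqueness transfer `chordalNearest_eq_of_existsUnique`; the junk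
  value is ONE constant whenever there is no minimiser (`chordalNearest_of_not_exists`).
* equivariance whenever the minimiser is unique: under any map rescaling the criterion by a positive
  `x`-dependent factor (`chordalNearest_image`), hence under linear isometries (`O(d)`:
  `chordalNearest_image_linearIsometry`, the criterion is invariant) and under the unit inversion
  `ι = EuclideanGeometry.inversion 0 1` for `x ≠ 0`, `0 ∉ ω` (`chordalNearest_image_inversion`; the criterion
  transforms by the `x`-only factor `‖x‖⁻²`, `chordalCriterion_inversion`).
* level sets of the criterion are spheres or hyperplanes, hence null for an additive Haar measure on a
  finite-dimensional inner product space (`addHaar_chordalCriterion_fiber`) — the input for "ties are a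
  null event" under a Poisson process with a density (`IsPoissonPointProcess.ae_injOn` of
  `PoissonDistinctValues`; packaged in `ChordalNearestPoisson`).
* measurability for the count σ-algebra of `PointConfig`: the minimiser relation is jointly measurable
  (`measurableSet_isChordalNearest`), the number of minimisers is measurable
  (`measurable_count_isChordalNearest`), so are the events "unique minimiser" / "no tie"
  (`measurableSet_existsUnique_isChordalNearest`, `measurableSet_subsingleton_isChordalNearest`), and
  `(ω, x) ↦ chordalNearest ω x` is measurable AWAY FROM TIES (`measurableSet_inter_preimage_chordalNearest`),
  hence a.e.-measurable under any law charging no ties (`aemeasurable_chordalNearest`). On the tie event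
  Hilbert's `ε` is uncontrolled, so nothing more can be said of the inline term.

## Design

The criterion needs only a norm (`NormedAddCommGroup E`); the inversion lemmas need an inner product;
the measurability lemmas need `E` second countable, σ-compact, Borel (the counting kernel of
`PointConfigKernel`). No new named facts.

## References

* A. F. Beardon, *The Geometry of Discrete Groups*, GTM 91, Springer (1983), §3.1, eq. (3.1.3) (the
  chordal metric `d(x, y) = 2|x - y| / ((1 + |x|²)^{1/2} (1 + |y|²)^{1/2})` on `ℝⁿ ∪ {∞}`).
* L. V. Ahlfors, *Complex Analysis*, 3rd ed., McGraw–Hill (1979), Ch. 1, "The Spherical Representation"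
  (the same formula for the Riemann sphere).
* G. Last, M. Penrose, *Lectures on the Poisson Process*, Cambridge Univ. Press (2017), Ch. 2 (count
  σ-algebra, Campbell measurability).
-/

open MeasureTheory Set
open scoped ENNReal

namespace Literature.Analysis.FunctionSpaces

section Criterion

variable {E : Type*} [NormedAddCommGroup E]

/-- The **chordal criterion** `‖x - p‖² / (1 + ‖p‖²)`: for fixed `x`, an increasing function of the chordal
(stereographic) distance between `x` and `p` (`chordalDist_sq`: `chord² = 4/(1+‖x‖²) · criterion`,
Beardon 1983, §3.1, eq. (3.1.3)). [folklore] -/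
noncomputable def chordalCriterion (x p : E) : ℝ := ‖x - p‖ ^ 2 / (1 + ‖p‖ ^ 2)

/-- Unfolding `chordalCriterion`. [folklore] -/
theorem chordalCriterion_def (x p : E) : chordalCriterion x p = ‖x - p‖ ^ 2 / (1 + ‖p‖ ^ 2) := rfl

/-- The chordal criterion is nonnegative. [folklore] -/
theorem chordalCriterion_nonneg (x p : E) : 0 ≤ chordalCriterion x p := by
  unfold chordalCriterion; positivity

/-- The chordal criterion vanishes exactly at `p = x`. [folklore] -/
theorem chordalCriterion_eq_zero_iff (x p : E) : chordalCriterion x p = 0 ↔ p = x := by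
  rw [chordalCriterion, div_eq_zero_iff, or_iff_left (by positivity : (1 + ‖p‖ ^ 2) ≠ 0),
    sq_eq_zero_iff, norm_eq_zero, sub_eq_zero, eq_comm]

/-- The chordal criterion is jointly continuous. [folklore] -/
theorem continuous_chordalCriterion : Continuous fun z : E × E => chordalCriterion z.1 z.2 := by
  unfold chordalCriterion
  exact ((continuous_norm.comp (continuous_fst.sub continuous_snd)).pow 2).div
    (continuous_const.add ((continuous_norm.comp continuous_snd).pow 2)) fun z => by positivity

/-- The **chordal distance** `2‖x - p‖ / √((1 + ‖x‖²)(1 + ‖p‖²))`: the Euclidean distance between the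
stereographic images of `x` and `p` on the unit sphere of `E × ℝ`, i.e. the chordal metric of `ℝⁿ ∪ {∞}`
restricted to finite points (Beardon 1983, §3.1, eq. (3.1.3); Ahlfors, Ch. 1, for `E = ℂ`).
[cite: Beardon1983, §3.1 eq. (3.1.3)] -/
noncomputable def chordalDist (x p : E) : ℝ :=
  2 * ‖x - p‖ / Real.sqrt ((1 + ‖x‖ ^ 2) * (1 + ‖p‖ ^ 2))

/-- Unfolding `chordalDist`. [folklore] -/
theorem chordalDist_def (x p : E) :
    chordalDist x p = 2 * ‖x - p‖ / Real.sqrt ((1 + ‖x‖ ^ 2) * (1 + ‖p‖ ^ 2)) := rfl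

/-- The chordal distance is nonnegative. [folklore] -/
theorem chordalDist_nonneg (x p : E) : 0 ≤ chordalDist x p := by
  unfold chordalDist; positivity

/-- The chordal distance is symmetric. [folklore] -/
theorem chordalDist_comm (x p : E) : chordalDist x p = chordalDist p x := by
  rw [chordalDist, chordalDist, norm_sub_rev, mul_comm (1 + ‖x‖ ^ 2)]

/-- `chord(x,p)² = 4/(1+‖x‖²) · ‖x-p‖²/(1+‖p‖²)`: the squared chordal distance is the chordal criterion up
to a positive factor depending on `x` only. [folklore] -/
theorem chordalDist_sq (x p : E) :
    chordalDist x p ^ 2 = 4 / (1 + ‖x‖ ^ 2) * chordalCriterion x p := by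
  have hx : 0 < 1 + ‖x‖ ^ 2 := by positivity
  have hp : 0 < 1 + ‖p‖ ^ 2 := by positivity
  rw [chordalDist, chordalCriterion, div_pow, mul_pow, Real.sq_sqrt (mul_pos hx hp).le]
  field_simp
  ring

/-- For fixed `x`, comparing chordal distances is comparing chordal criteria. [folklore] -/
theorem chordalDist_le_chordalDist_iff (x p q : E) :
    chordalDist x p ≤ chordalDist x q ↔ chordalCriterion x p ≤ chordalCriterion x q := by
  rw [← pow_le_pow_iff_left₀ (chordalDist_nonneg x p) (chordalDist_nonneg x q) two_ne_zero,
    chordalDist_sq, chordalDist_sq]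
  exact mul_le_mul_iff_right₀ (by positivity)

/-! ### Minimisers and the chordal-nearest point -/

/-- `IsChordalNearest ω x p`: `p` is a point of `ω` minimising the chordal criterion `‖x - ·‖²/(1 + ‖·‖²)`
(equivalently the chordal distance to `x`, `isChordalNearest_iff_chordalDist`) over `ω`. Written with
the literal inline term of route `ConformalPoissonDevice`. [folklore] -/
def IsChordalNearest (ω : Set E) (x p : E) : Prop :=
  p ∈ ω ∧ ∀ q ∈ ω, ‖x - p‖ ^ 2 / (1 + ‖p‖ ^ 2) ≤ ‖x - q‖ ^ 2 / (1 + ‖q‖ ^ 2)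

/-- `IsChordalNearest` in terms of `chordalCriterion`. [folklore] -/
theorem isChordalNearest_iff {ω : Set E} {x p : E} :
    IsChordalNearest ω x p ↔ p ∈ ω ∧ ∀ q ∈ ω, chordalCriterion x p ≤ chordalCriterion x q :=
  Iff.rfl

/-- `IsChordalNearest` in terms of the chordal distance: `p ∈ ω` is (weakly) closest to `x` among the
points of `ω` in the chordal metric. [folklore] -/
theorem isChordalNearest_iff_chordalDist {ω : Set E} {x p : E} :
    IsChordalNearest ω x p ↔ p ∈ ω ∧ ∀ q ∈ ω, chordalDist x p ≤ chordalDist x q := by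
  simp only [isChordalNearest_iff, chordalDist_le_chordalDist_iff]

/-- A minimiser belongs to the set. [folklore] -/
theorem IsChordalNearest.mem {ω : Set E} {x p : E} (h : IsChordalNearest ω x p) : p ∈ ω := h.1

/-- A minimiser minimises the criterion. [folklore] -/
theorem IsChordalNearest.le {ω : Set E} {x p q : E} (h : IsChordalNearest ω x p) (hq : q ∈ ω) :
    chordalCriterion x p ≤ chordalCriterion x q :=
  h.2 q hq

/-- Two minimisers have the same criterion value. [folklore] -/
theorem IsChordalNearest.chordalCriterion_eq {ω : Set E} {x p q : E} (hp : IsChordalNearest ω x p)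
    (hq : IsChordalNearest ω x q) : chordalCriterion x p = chordalCriterion x q :=
  le_antisymm (hp.le hq.mem) (hq.le hp.mem)

/-- If the criterion `chordalCriterion x` is injective on `ω` (no ties at all), minimisers are unique.
[folklore] -/
theorem subsingleton_setOf_isChordalNearest_of_injOn {ω : Set E} {x : E}
    (h : Set.InjOn (chordalCriterion x) ω) : {p | IsChordalNearest ω x p}.Subsingleton :=
  fun _ hp _ hq => h hp.mem hq.mem (hp.chordalCriterion_eq hq)

/-- **The chordal-nearest point** of `ω` to `x`: a point of `ω` minimising `‖x - p‖²/(1 + ‖p‖²)` over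
`p ∈ ω`, i.e. nearest to `x` in the chordal metric of the sphere pulled back by stereographic projection;
Hilbert-`ε` junk when no minimiser exists (then a constant, `chordalNearest_of_not_exists`) and an
unspecified minimiser when several exist. This is verbatim the inline term of the items of route
`ConformalPoissonDevice` (`chordalNearest_coe`). [folklore] -/
noncomputable def chordalNearest (ω : Set E) (x : E) : E :=
  Classical.epsilon fun p : E => p ∈ ω ∧ ∀ q ∈ ω, ‖x - p‖ ^ 2 / (1 + ‖p‖ ^ 2) ≤ ‖x - q‖ ^ 2 / (1 + ‖q‖ ^ 2)

/-- Unfolding: `chordalNearest ω x` is Hilbert's `ε` of the minimiser predicate. [folklore] -/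
theorem chordalNearest_def (ω : Set E) (x : E) :
    chordalNearest ω x = Classical.epsilon (IsChordalNearest ω x) := rfl

/-- **Bridge to the route's inline term**: for a configuration `c : PointConfig E` the route writes
membership in `c` itself; the two terms agree definitionally. [folklore] -/
theorem chordalNearest_coe (c : PointConfig E) (x : E) :
    chordalNearest (c : Set E) x = Classical.epsilon fun p : E =>
      p ∈ c ∧ ∀ q ∈ c, ‖x - p‖ ^ 2 / (1 + ‖p‖ ^ 2) ≤ ‖x - q‖ ^ 2 / (1 + ‖q‖ ^ 2) :=
  rfl

/-- If a minimiser exists, `chordalNearest ω x` is one (Hilbert `ε`). [folklore] -/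
theorem chordalNearest_spec {ω : Set E} {x : E} (h : ∃ p, IsChordalNearest ω x p) :
    IsChordalNearest ω x (chordalNearest ω x) :=
  Classical.epsilon_spec h

/-- **Existence**: a finite nonempty set has a chordal-nearest point to every `x`. [folklore] -/
theorem exists_isChordalNearest {ω : Set E} (hω : ω.Finite) (hne : ω.Nonempty) (x : E) :
    ∃ p, IsChordalNearest ω x p := by
  obtain ⟨p, hp, hmin⟩ := Set.exists_min_image ω (chordalCriterion x) hω hne
  exact ⟨p, hp, hmin⟩

/-- For finite nonempty `ω`, `chordalNearest ω x ∈ ω`. [folklore] -/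
theorem chordalNearest_mem {ω : Set E} (hω : ω.Finite) (hne : ω.Nonempty) (x : E) :
    chordalNearest ω x ∈ ω :=
  (chordalNearest_spec (exists_isChordalNearest hω hne x)).mem

/-- For finite nonempty `ω`, `chordalNearest ω x` minimises the chordal criterion over `ω`. [folklore] -/
theorem chordalCriterion_chordalNearest_le {ω : Set E} (hω : ω.Finite) (hne : ω.Nonempty) (x : E)
    {q : E} (hq : q ∈ ω) : chordalCriterion x (chordalNearest ω x) ≤ chordalCriterion x q :=
  (chordalNearest_spec (exists_isChordalNearest hω hne x)).le hq

/-- **Uniqueness transfer**: if the minimiser is unique, `chordalNearest ω x` is it. [folklore] -/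
theorem chordalNearest_eq_of_existsUnique {ω : Set E} {x : E} (hu : ∃! p, IsChordalNearest ω x p)
    {p : E} (hp : IsChordalNearest ω x p) : chordalNearest ω x = p :=
  hu.unique (chordalNearest_spec hu.exists) hp

/-- **The junk value is one constant**: when no minimiser exists (e.g. `ω = ∅`), the minimiser predicate
is extensionally `False`, so `chordalNearest ω x = ε (fun _ => False)` whatever `ω` and `x`. [folklore] -/
theorem chordalNearest_of_not_exists {ω : Set E} {x : E} (h : ¬ ∃ p, IsChordalNearest ω x p) :
    chordalNearest ω x = Classical.epsilon fun _ : E => False := by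
  rw [chordalNearest_def]
  congr 1
  funext p
  exact propext ⟨fun hp => h ⟨p, hp⟩, False.elim⟩

/-- The chordal-nearest point of the empty set is the junk constant. [folklore] -/
theorem chordalNearest_empty (x : E) :
    chordalNearest (∅ : Set E) x = Classical.epsilon fun _ : E => False :=
  chordalNearest_of_not_exists fun ⟨_, hp, _⟩ => hp

/-- The chordal-nearest point of a singleton is its point. [folklore] -/
theorem chordalNearest_singleton (p x : E) : chordalNearest {p} x = p := by
  have h : IsChordalNearest ({p} : Set E) x p :=
    ⟨mem_singleton p, fun q hq => by rw [mem_singleton_iff.1 hq]⟩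
  exact chordalNearest_eq_of_existsUnique ⟨p, h, fun q hq => mem_singleton_iff.1 hq.mem⟩ h

/-! ### Equivariance -/

/-- **Abstract equivariance.** If `f` rescales the chordal criterion seen from `x` by a positive factor
on `ω` (`crit (f x) (f p) = c · crit x p` for `p ∈ ω`), then minimisers correspond, and when the minimiser
over `ω` is unique, `chordalNearest (f '' ω) (f x) = f (chordalNearest ω x)`. [folklore] -/
theorem chordalNearest_image {F : Type*} [NormedAddCommGroup F] {f : E → F} {ω : Set E} {x : E}
    {c : ℝ} (hc : 0 < c) (hf : ∀ p ∈ ω, chordalCriterion (f x) (f p) = c * chordalCriterion x p)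
    (hu : ∃! p, IsChordalNearest ω x p) :
    chordalNearest (f '' ω) (f x) = f (chordalNearest ω x) := by
  have h₀ : IsChordalNearest ω x (chordalNearest ω x) := chordalNearest_spec hu.exists
  -- the image of the minimiser is a minimiser of the image
  have h₁ : IsChordalNearest (f '' ω) (f x) (f (chordalNearest ω x)) := by
    refine isChordalNearest_iff.2 ⟨mem_image_of_mem f h₀.mem, ?_⟩
    rintro _ ⟨q, hq, rfl⟩
    rw [hf _ h₀.mem, hf _ hq]
    exact mul_le_mul_of_nonneg_left (h₀.le hq) hc.le
  -- any minimiser of the image comes from a minimiser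
  have h₂ : IsChordalNearest (f '' ω) (f x) (chordalNearest (f '' ω) (f x)) :=
    chordalNearest_spec ⟨_, h₁⟩
  obtain ⟨p₁, hp₁, hp₁eq⟩ := (mem_image _ _ _).1 h₂.mem
  have h₃ : IsChordalNearest ω x p₁ := by
    refine isChordalNearest_iff.2 ⟨hp₁, fun q hq => ?_⟩
    have := h₂.le (mem_image_of_mem f hq)
    rw [← hp₁eq, hf _ hp₁, hf _ hq] at this
    exact le_of_mul_le_mul_left this hc
  rw [← hp₁eq, hu.unique h₃ h₀]

end Criterion

section Isometry

variable {E F : Type*} [NormedAddCommGroup E] [NormedSpace ℝ E] [NormedAddCommGroup F] [NormedSpace ℝ F]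

/-- Linear isometries preserve the chordal criterion. [folklore] -/
theorem chordalCriterion_linearIsometry (R : E →ₗᵢ[ℝ] F) (x p : E) :
    chordalCriterion (R x) (R p) = chordalCriterion x p := by
  rw [chordalCriterion, chordalCriterion, ← map_sub, R.norm_map, R.norm_map]

/-- **`O(d)`-equivariance**: for a linear isometry `R` (in particular an orthogonal transformation) and a
unique minimiser, `chordalNearest (R '' ω) (R x) = R (chordalNearest ω x)`. [folklore] -/
theorem chordalNearest_image_linearIsometry (R : E →ₗᵢ[ℝ] F) {ω : Set E} {x : E}
    (hu : ∃! p, IsChordalNearest ω x p) :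
    chordalNearest (R '' ω) (R x) = R (chordalNearest ω x) :=
  chordalNearest_image one_pos (fun p _ => by rw [chordalCriterion_linearIsometry, one_mul]) hu

end Isometry

section Inversion

variable {E : Type*} [NormedAddCommGroup E] [InnerProductSpace ℝ E]

/-- **The chordal criterion under the unit inversion** `ι = inversion 0 1` (`ι z = z/‖z‖²`): for
`x, p ≠ 0`, `crit (ι x) (ι p) = ‖x‖⁻² · crit x p` — an `x`-only factor (from
`‖ι x - ι p‖ = ‖x - p‖/(‖x‖‖p‖)` and `‖ι p‖ = ‖p‖⁻¹`). [folklore] -/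
theorem chordalCriterion_inversion {x p : E} (hx : x ≠ 0) (hp : p ≠ 0) :
    chordalCriterion (EuclideanGeometry.inversion 0 1 x) (EuclideanGeometry.inversion 0 1 p) =
      (‖x‖ ^ 2)⁻¹ * chordalCriterion x p := by
  have h1 : ‖EuclideanGeometry.inversion 0 1 x - EuclideanGeometry.inversion 0 1 p‖ =
      ‖x - p‖ / (‖x‖ * ‖p‖) := by
    rw [← dist_eq_norm, EuclideanGeometry.dist_inversion_inversion hx hp, dist_zero_right,
      dist_zero_right, dist_eq_norm]
    ring
  have h2 : ‖EuclideanGeometry.inversion 0 1 p‖ = ‖p‖⁻¹ := by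
    rw [← dist_zero_right, EuclideanGeometry.dist_inversion_center, dist_zero_right]
    ring
  have hx' : ‖x‖ ≠ 0 := norm_ne_zero_iff.2 hx
  have hp' : ‖p‖ ≠ 0 := norm_ne_zero_iff.2 hp
  rw [chordalCriterion, chordalCriterion, h1, h2]
  field_simp
  ring

/-- **Inversion equivariance**: for `x ≠ 0`, `0 ∉ ω` and a unique minimiser,
`chordalNearest (ι '' ω) (ι x) = ι (chordalNearest ω x)` with `ι = EuclideanGeometry.inversion 0 1`.
[folklore] -/
theorem chordalNearest_image_inversion {ω : Set E} {x : E} (hx : x ≠ 0) (hω : (0 : E) ∉ ω)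
    (hu : ∃! p, IsChordalNearest ω x p) :
    chordalNearest (EuclideanGeometry.inversion 0 1 '' ω) (EuclideanGeometry.inversion 0 1 x) =
      EuclideanGeometry.inversion 0 1 (chordalNearest ω x) :=
  chordalNearest_image (by positivity : 0 < (‖x‖ ^ 2)⁻¹)
    (fun p hp => chordalCriterion_inversion hx fun h => hω (h ▸ hp)) hu

/-! ### Level sets of the criterion are null -/

/-- On the level set `crit x q = 1` one has `2⟨x, q⟩ = ‖x‖² - 1` (a hyperplane, empty if `x = 0`).
[folklore] -/
theorem inner_eq_of_chordalCriterion_eq_one {x q : E} (h : chordalCriterion x q = 1) :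
    2 * inner ℝ x q = ‖x‖ ^ 2 - 1 := by
  rw [chordalCriterion, div_eq_one_iff_eq (by positivity : (1 + ‖q‖ ^ 2) ≠ 0),
    norm_sub_sq_real] at h
  linarith

/-- On a level set `crit x q = t` with `t ≠ 1` one has `‖q - (1 - t)⁻¹ • x‖² = const(x, t)` (a sphere,
possibly empty or a point). [folklore] -/
theorem norm_sub_sq_eq_of_chordalCriterion_eq {x q : E} {t : ℝ} (ht : t ≠ 1)
    (h : chordalCriterion x q = t) :
    ‖q - (1 - t)⁻¹ • x‖ ^ 2 = (t - ‖x‖ ^ 2) / (1 - t) + ‖x‖ ^ 2 / (1 - t) ^ 2 := by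
  have hs : (1 - t) ≠ 0 := sub_ne_zero.2 (Ne.symm ht)
  rw [chordalCriterion, div_eq_iff (by positivity : (1 + ‖q‖ ^ 2) ≠ 0), norm_sub_sq_real] at h
  rw [norm_sub_sq_real, real_inner_smul_right, norm_smul, Real.norm_eq_abs, mul_pow, sq_abs,
    real_inner_comm]
  field_simp
  linear_combination (1 - t) * h

variable [FiniteDimensional ℝ E] [MeasurableSpace E] [BorelSpace E]

/-- **Level sets of the chordal criterion are Haar-null**: `μ {q | crit x q = t} = 0` for an additive
Haar measure `μ` on a nontrivial finite-dimensional real inner product space — the level set is a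
sphere (`t ≠ 1`; `Measure.addHaar_sphere`) or a hyperplane / empty (`t = 1`; `Measure.addHaar_submodule`
for `(ℝ ∙ x)ᗮ`). Hence ties of the criterion are null for any intensity with a Lebesgue density.
[folklore] -/
theorem addHaar_chordalCriterion_fiber [Nontrivial E] (μ : Measure E) [μ.IsAddHaarMeasure] (x : E)
    (t : ℝ) : μ (chordalCriterion x ⁻¹' {t}) = 0 := by
  rcases eq_or_ne t 1 with rfl | ht
  · rcases eq_or_ne x 0 with rfl | hx
    · -- empty level set
      have : chordalCriterion (0 : E) ⁻¹' {1} = ∅ := by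
        ext q
        simp only [mem_preimage, mem_singleton_iff, mem_empty_iff_false, iff_false]
        intro hq
        have := inner_eq_of_chordalCriterion_eq_one hq
        rw [inner_zero_left, norm_zero] at this
        norm_num at this
      rw [this, measure_empty]
    · -- a translate of the hyperplane `(ℝ ∙ x)ᗮ`
      set K : Submodule ℝ E := (ℝ ∙ x)ᗮ with hK
      have hKμ : μ K = 0 := Measure.addHaar_submodule μ K (by
        rw [hK, Ne, Submodule.orthogonal_eq_top_iff, Submodule.span_singleton_eq_bot]
        exact hx)
      rcases (chordalCriterion x ⁻¹' {1}).eq_empty_or_nonempty with h0 | ⟨q₀, hq₀⟩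
      · rw [h0, measure_empty]
      · refine measure_mono_null (t := (fun q => -q₀ + q) ⁻¹' K) (fun q hq => ?_)
          (by rw [measure_preimage_add]; exact hKμ)
        have h1 := inner_eq_of_chordalCriterion_eq_one (mem_singleton_iff.1 hq)
        have h2 := inner_eq_of_chordalCriterion_eq_one (mem_singleton_iff.1 hq₀)
        simp only [mem_preimage, SetLike.mem_coe, hK, Submodule.mem_orthogonal_singleton_iff_inner_right,
          inner_add_right, inner_neg_right]
        linarith
  · -- a sphere
    refine measure_mono_null (fun q hq => ?_)
      (Measure.addHaar_sphere μ ((1 - t)⁻¹ • x)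
        (Real.sqrt ((t - ‖x‖ ^ 2) / (1 - t) + ‖x‖ ^ 2 / (1 - t) ^ 2)))
    rw [Metric.mem_sphere, dist_eq_norm, ← norm_sub_sq_eq_of_chordalCriterion_eq ht (mem_singleton_iff.1 hq),
      Real.sqrt_sq (norm_nonneg _)]

end Inversion

/-! ### Measurability for the count σ-algebra of `PointConfig` -/

section Measurability

variable {E : Type*} [NormedAddCommGroup E] [MeasurableSpace E] [BorelSpace E]
  [SecondCountableTopology E] [SigmaCompactSpace E]
  {α : Type*} [MeasurableSpace α] {g : α → PointConfig E} {y : α → E}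

/-- **The minimiser relation is jointly measurable**: for measurable families of configurations `g a`
and points `y a`, `{(a, q) | IsChordalNearest (g a) (y a) q}` is measurable — "`q` minimises" is the void
event `N_{g a}{q' | crit (y a) q' < crit (y a) q} = 0` of a measurably parametrised set
(`PointConfig.measurableSet_count_preimage_eq_zero`) and membership is measurable
(`PointConfig.measurableSet_mem_comp`). [folklore] -/
theorem measurableSet_isChordalNearest (hg : Measurable g) (hy : Measurable y) :
    MeasurableSet {p : α × E | IsChordalNearest (g p.1 : Set E) (y p.1) p.2} := by
  have h1 : MeasurableSet {p : α × E | p.2 ∈ g p.1} :=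
    PointConfig.measurableSet_mem_comp measurable_snd (hg.comp measurable_fst)
  set T : Set ((α × E) × E) :=
    {r | chordalCriterion (y r.1.1) r.2 < chordalCriterion (y r.1.1) r.1.2} with hT
  have hc : Measurable fun z : E × E => chordalCriterion z.1 z.2 :=
    continuous_chordalCriterion.measurable
  have hTm : MeasurableSet T :=
    measurableSet_lt (hc.comp ((hy.comp (measurable_fst.comp measurable_fst)).prodMk measurable_snd))
      (hc.comp ((hy.comp (measurable_fst.comp measurable_fst)).prodMk
        (measurable_snd.comp measurable_fst)))
  have h2 : MeasurableSet {p : α × E | (g p.1).count (Prod.mk p ⁻¹' T) = 0} :=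
    PointConfig.measurableSet_count_preimage_eq_zero hTm (hg.comp measurable_fst)
  convert h1.inter h2 using 1
  ext p
  simp only [mem_setOf_eq, mem_inter_iff]
  rw [isChordalNearest_iff, PointConfig.count, Set.encard_eq_zero]
  refine and_congr Iff.rfl ⟨fun h => ?_, fun h q hq => ?_⟩
  · ext q'
    simp only [mem_inter_iff, mem_preimage, hT, mem_setOf_eq, mem_empty_iff_false, iff_false, not_and,
      not_lt, PointConfig.mem_carrier]
    exact fun hq' => h q' hq'
  · by_contra hlt
    have hq' : q ∈ (g p.1).carrier ∩ Prod.mk p ⁻¹' T := ⟨hq, not_le.1 hlt⟩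
    rw [h] at hq'
    exact hq'

/-- **The number of minimisers in a measurable set is measurable**: `a ↦ N_{g a}({q | IsChordalNearest
(g a) (y a) q} ∩ s)` is measurable for measurable `s` (parametrised counts, `PointConfig.measurable_toMeasure_preimage`).
[folklore] -/
theorem measurable_count_isChordalNearest (hg : Measurable g) (hy : Measurable y) {s : Set E}
    (hs : MeasurableSet s) :
    Measurable fun a => (g a).count ({q | IsChordalNearest (g a : Set E) (y a) q} ∩ s) := by
  set S : Set (α × E) := {p | IsChordalNearest (g p.1 : Set E) (y p.1) p.2} ∩ Prod.snd ⁻¹' s with hS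
  have hSm : MeasurableSet S := (measurableSet_isChordalNearest hg hy).inter (measurable_snd hs)
  have h1 : Measurable fun a => (g a).toMeasure (Prod.mk a ⁻¹' S) :=
    PointConfig.measurable_toMeasure_preimage hSm hg
  have h2 : ∀ a, (g a).toMeasure (Prod.mk a ⁻¹' S) =
      (((g a).count ({q | IsChordalNearest (g a : Set E) (y a) q} ∩ s) : ℕ∞) : ℝ≥0∞) := fun a => by
    rw [PointConfig.toMeasure_apply _ (measurable_prodMk_left hSm)]
    rfl
  simp_rw [h2] at h1
  refine measurable_to_countable' fun n => ?_
  have : (fun a => (g a).count ({q | IsChordalNearest (g a : Set E) (y a) q} ∩ s)) ⁻¹' {n} =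
      (fun a => (((g a).count ({q | IsChordalNearest (g a : Set E) (y a) q} ∩ s) : ℕ∞) : ℝ≥0∞)) ⁻¹'
        {(n : ℝ≥0∞)} := by
    ext a
    simp only [mem_preimage, mem_singleton_iff, ENat.toENNReal_inj]
  rw [this]
  exact h1 (measurableSet_singleton _)

omit [MeasurableSpace E] [BorelSpace E] [SecondCountableTopology E] [SigmaCompactSpace E] in
/-- The count of minimisers is the cardinality of the set of minimisers (minimisers are points of the
configuration). [folklore] -/
theorem count_setOf_isChordalNearest (c : PointConfig E) (x : E) :
    c.count {q | IsChordalNearest (c : Set E) x q} = {q | IsChordalNearest (c : Set E) x q}.encard := by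
  rw [PointConfig.count]
  congr 1
  exact inter_eq_right.2 fun q hq => hq.mem

omit [MeasurableSpace E] [BorelSpace E] [SecondCountableTopology E] [SigmaCompactSpace E] in
/-- The count of minimisers in `s` is the cardinality of the set of minimisers in `s` (minimisers are
points of the configuration). [folklore] -/
theorem count_isChordalNearest_inter (c : PointConfig E) (x : E) (s : Set E) :
    c.count ({q | IsChordalNearest (c : Set E) x q} ∩ s) =
      ({q | IsChordalNearest (c : Set E) x q} ∩ s).encard := by
  rw [PointConfig.count]
  congr 1
  exact inter_eq_right.2 fun q hq => hq.1.mem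

/-- **The event "the chordal-nearest point is unique" is measurable.** [folklore] -/
theorem measurableSet_existsUnique_isChordalNearest (hg : Measurable g) (hy : Measurable y) :
    MeasurableSet {a | ∃! q, IsChordalNearest (g a : Set E) (y a) q} := by
  have h := measurable_count_isChordalNearest hg hy MeasurableSet.univ (measurableSet_singleton 1)
  convert h using 1
  ext a
  simp only [mem_setOf_eq, mem_preimage, mem_singleton_iff, inter_univ, count_setOf_isChordalNearest,
    Set.encard_eq_one]
  constructor
  · rintro ⟨q, hq, huq⟩
    exact ⟨q, Set.eq_singleton_iff_unique_mem.2 ⟨hq, fun q' hq' => huq q' hq'⟩⟩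
  · rintro ⟨q, hq⟩
    obtain ⟨hq1, hq2⟩ := Set.eq_singleton_iff_unique_mem.1 hq
    exact ⟨q, hq1, hq2⟩

/-- **The event "no tie for the chordal-nearest point" is measurable.** [folklore] -/
theorem measurableSet_subsingleton_isChordalNearest (hg : Measurable g) (hy : Measurable y) :
    MeasurableSet {a | {q | IsChordalNearest (g a : Set E) (y a) q}.Subsingleton} := by
  have h := measurable_count_isChordalNearest hg hy MeasurableSet.univ
    (MeasurableSet.of_discrete (s := Iic (1 : ℕ∞)))
  convert h using 1
  ext a
  simp only [mem_setOf_eq, mem_preimage, mem_Iic, inter_univ, count_setOf_isChordalNearest,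
    Set.encard_le_one_iff_subsingleton]

/-- **The event "a chordal-nearest point exists" is measurable.** [folklore] -/
theorem measurableSet_exists_isChordalNearest (hg : Measurable g) (hy : Measurable y) :
    MeasurableSet {a | ∃ q, IsChordalNearest (g a : Set E) (y a) q} := by
  have h := (measurable_count_isChordalNearest hg hy MeasurableSet.univ (measurableSet_singleton 0)).compl
  convert h using 1
  ext a
  simp only [mem_setOf_eq, mem_compl_iff, mem_preimage, mem_singleton_iff, inter_univ,
    count_setOf_isChordalNearest, Set.encard_eq_zero, ← Ne.eq_def, ← nonempty_iff_ne_empty]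
  rfl

/-- **`chordalNearest` is measurable away from ties**: for measurable `s ⊆ E`, the part of the preimage
`{a | chordalNearest (g a) (y a) ∈ s}` inside the no-tie event is measurable. On "no minimiser" the
value is a constant (`chordalNearest_of_not_exists`); on "unique minimiser" `chordalNearest ∈ s` iff the
configuration has a minimiser in `s`, a measurable count event. (On the tie event Hilbert's `ε` is
uncontrolled.) [folklore] -/
theorem measurableSet_inter_preimage_chordalNearest (hg : Measurable g) (hy : Measurable y) {s : Set E}
    (hs : MeasurableSet s) :
    MeasurableSet ({a | {q | IsChordalNearest (g a : Set E) (y a) q}.Subsingleton} ∩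
      (fun a => chordalNearest (g a : Set E) (y a)) ⁻¹' s) := by
  -- split the no-tie event into "no minimiser" and "unique minimiser"
  have hsplit : {a | {q | IsChordalNearest (g a : Set E) (y a) q}.Subsingleton} ∩
      (fun a => chordalNearest (g a : Set E) (y a)) ⁻¹' s =
      ({a | ¬ ∃ q, IsChordalNearest (g a : Set E) (y a) q} ∩
          {_a | Classical.epsilon (fun _ : E => False) ∈ s}) ∪
        ({a | ∃! q, IsChordalNearest (g a : Set E) (y a) q} ∩
          {a | (g a).count ({q | IsChordalNearest (g a : Set E) (y a) q} ∩ s) ≠ 0}) := by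
    ext a
    simp only [mem_inter_iff, mem_setOf_eq, mem_preimage, mem_union]
    constructor
    · rintro ⟨hsub, hmem⟩
      by_cases hex : ∃ q, IsChordalNearest (g a : Set E) (y a) q
      · right
        have hsp := chordalNearest_spec hex
        refine ⟨⟨_, hsp, fun q hq => hsub hq hsp⟩, ?_⟩
        rw [count_isChordalNearest_inter, Ne, Set.encard_eq_zero, ← Ne, ← nonempty_iff_ne_empty]
        exact ⟨_, hsp, hmem⟩
      · left
        exact ⟨hex, by rwa [chordalNearest_of_not_exists hex] at hmem⟩
    · rintro (⟨hex, hmem⟩ | ⟨hu, hcount⟩)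
      · refine ⟨fun q hq => (hex ⟨q, hq⟩).elim, ?_⟩
        rwa [chordalNearest_of_not_exists hex]
      · refine ⟨fun q hq q' hq' => hu.unique hq hq', ?_⟩
        rw [count_isChordalNearest_inter, Ne, Set.encard_eq_zero, ← Ne, ← nonempty_iff_ne_empty] at hcount
        obtain ⟨q, hq, hqs⟩ := hcount
        rwa [chordalNearest_eq_of_existsUnique hu hq]
  rw [hsplit]
  refine MeasurableSet.union ?_ ?_
  · exact (measurableSet_exists_isChordalNearest hg hy).compl.inter (MeasurableSet.const _)
  · exact (measurableSet_existsUnique_isChordalNearest hg hy).inter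
      ((measurable_count_isChordalNearest hg hy hs (measurableSet_singleton 0)).compl)

/-- **`chordalNearest` is a.e.-measurable under any law charging no ties**: if `μ`-a.e. the minimiser
set is a subsingleton, `a ↦ chordalNearest (g a) (y a)` is `AEMeasurable μ` (it agrees off the null tie
event with its measurable modification by the junk constant). Under a Poisson process with a Lebesgue
density ties are null (`ChordalNearestPoisson`). [folklore] -/
theorem aemeasurable_chordalNearest (hg : Measurable g) (hy : Measurable y) {μ : Measure α}
    (hμ : ∀ᵐ a ∂μ, {q | IsChordalNearest (g a : Set E) (y a) q}.Subsingleton) :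
    AEMeasurable (fun a => chordalNearest (g a : Set E) (y a)) μ := by
  classical
  set U : Set α := {a | {q | IsChordalNearest (g a : Set E) (y a) q}.Subsingleton} with hU
  have hUm : MeasurableSet U := measurableSet_subsingleton_isChordalNearest hg hy
  refine ⟨U.piecewise (fun a => chordalNearest (g a : Set E) (y a))
    (fun _ => Classical.epsilon fun _ : E => False), fun s hs => ?_, ?_⟩
  · rw [piecewise_preimage, Set.ite]
    refine MeasurableSet.union ?_ ((MeasurableSet.const _).diff hUm)
    rw [inter_comm]
    exact measurableSet_inter_preimage_chordalNearest hg hy hs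
  · filter_upwards [hμ] with a ha
    rw [piecewise_eq_of_mem _ _ _ (show a ∈ U from ha)]

/-- Joint version on `PointConfig E × E`: the no-tie event `{(c, x) | no two chordal-nearest points}`
is measurable for the product of the count σ-algebra and the Borel σ-algebra. [folklore] -/
theorem measurableSet_subsingleton_isChordalNearest_prod :
    MeasurableSet {p : PointConfig E × E | {q | IsChordalNearest (p.1 : Set E) p.2 q}.Subsingleton} :=
  measurableSet_subsingleton_isChordalNearest measurable_fst measurable_snd

/-- Joint version: `(c, x) ↦ chordalNearest c x` is a.e.-measurable on `PointConfig E × E` under any law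
charging no ties. [folklore] -/
theorem aemeasurable_chordalNearest_prod {μ : Measure (PointConfig E × E)}
    (hμ : ∀ᵐ p ∂μ, {q | IsChordalNearest (p.1 : Set E) p.2 q}.Subsingleton) :
    AEMeasurable (fun p : PointConfig E × E => chordalNearest (p.1 : Set E) p.2) μ :=
  aemeasurable_chordalNearest measurable_fst measurable_snd hμ

/-- Fixed `x`: `c ↦ chordalNearest c x` is a.e.-measurable under any law `P` on configurations under
which ties at `x` are null. [folklore] -/
theorem aemeasurable_chordalNearest_left {P : Measure (PointConfig E)} (x : E)
    (hP : ∀ᵐ c ∂P, {q | IsChordalNearest ((c : PointConfig E) : Set E) x q}.Subsingleton) :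
    AEMeasurable (fun c : PointConfig E => chordalNearest (c : Set E) x) P :=
  aemeasurable_chordalNearest measurable_id measurable_const hP

end Measurability

end Literature.Analysis.FunctionSpaces
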